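import Mathlib.MeasureTheory.Integral.Pi
import Mathlib.MeasureTheory.Integral.Prod
import Mathlib.MeasureTheory.Constructions.Pi
import Mathlib.Analysis.SpecialFunctions.Exponential
import Literature.Analysis.FluidPDE.BBGKYMarginals
import HarnessLib

/-!
# Proofs for `Literature.Analysis.FluidPDE.BBGKYMarginals`: chaos of the grand-canonical data

Companion ("Proofs") file of `Literature.Analysis.FluidPDE.BBGKYMarginals` (trunk FluidKinetic /
T-KINETIC, item K3) discharging the named fact
`Literature.Analysis.FluidPDE.correlationFn_gcInitial_tendsto_tensorPow`
(`correlationFn_gcInitial_tendsto_tensorPow_holds`, at the end): in the Boltzmann–Grad scaling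
`μ_ε ε^{d-1} = 1` the rescaled correlation functions `F^{(s)}_ε` of the grand-canonical
Gibbs-type state `gcInitial G ε μ_ε f₀` converge to `f₀^{⊗s}(Z_s)` as `ε → 0⁺` at every
configuration `Z_s` with pairwise nonzero separation vectors. (The sibling
`BBGKYMarginalsProofs.lean` discharges other facts of the same statement file and is left
untouched; this file only adds a new module.)

## Source and architecture of the proof

Gallagher–Saint-Raymond–Texier 2013, Ch. 6 §6.1, Prop. 6.1.2 (canonical ensemble,
`N ε^{d-1} ≡ 1`; in the corrected arXiv version, arXiv:1208.5753v3, this is §6.1.2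
"Conditioning", Lemma 6.1.2, and §6.1.3, Prop. `init-cv1`, whose proof has a "first step" =
uniform bounds and a "second step" = convergence). The printed second step computes, for the
conditioned datum `𝒵_N⁻¹ 1_{D_N} f_0^{⊗N}`, by Fubini and symmetry
`f_{0,N}^{(s)} = 𝒵_N⁻¹ 1_{D_s} f_0^{⊗s} (𝒵_{N-s} - 𝒵^♭_{(s+1,N)})`, where `𝒵^♭` carries the
cross exclusion factor `1 - ∏_{i ≤ s < j} 1_{|x_i - x_j| > ε}`, bounds
`0 ≤ 1 - ∏ 1_{|x_i-x_j|>ε} ≤ ∑_{i ≤ s < j} 1_{|x_i - x_j| < ε}` and, removing the offending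
particle `j` by Fubini, `𝒵^♭_{(s+1,N)} ≤ s (N - s) ε^d κ_d |f_0|_{L^∞_x L^1_v} 𝒵_{N-s-1}`, and
concludes with the ratio bounds `1 ≤ 𝒵_N⁻¹ 𝒵_{N-s} ≤ (1 - ε κ_d |f_0|_{L^∞L^1})^{-s}` of
Lemma 6.1.2. The fact discharged here is the *grand-canonical* analogue (Bodineau–Gallagher–
Saint-Raymond–Simonella 2023 §1.1, (1.1.5)–(1.1.6)), pointwise in `Z_s`; the same architecture
gives, with `S_ε(Z_s) = {z | ∀ i, ε ≤ |x_i - x| both ways}` the set of one-particle states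
compatible with the tagged particles and `𝒵^ε[h] = ∑_N μ^N 𝒵_N[h] / N!`
(`gcPartition G ε μ h`):

* `indicator_hardSphereDomain_tensorPow_append`: the Gibbs weight factorises over the
  juxtaposition `(Z_s, Z_p)`,
  `1_{D^{s+p}} f₀^{⊗(s+p)} = (1_{D^s} f₀^{⊗s})(Z_s) · (1_{D^p} (1_{S_ε(Z_s)} f₀)^{⊗p})(Z_p)`
  (the cross exclusion factor is absorbed into the one-particle density), whence the exact
  identity `correlationFn_gcInitial_eq_mul_div`:
  `F^{(s)}_ε(Z_s) = 1_{D_ε^s}(Z_s) f₀^{⊗s}(Z_s) · 𝒵^ε[1_{S_ε(Z_s)} f₀] / 𝒵^ε[f₀]` (`μ ≠ 0`);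
* `canonicalPartition_succ_sub_indicator_le`, `gcPartition_sub_indicator_le`: the union bound
  `indicator_tensorPow_sub_le_sum` and the removal of one particle by Fubini
  (`integral_indicator_eval_mul_prod_le`, via `MeasurableEquiv.piFinSuccAbove`) give
  `𝒵_{n+1}[f] - 𝒵_{n+1}[1_S f] ≤ (n+1) (∫ 1_{Sᶜ} f) 𝒵_n[f]`, and summing against
  `μ^{n+1}/(n+1)!` the first-order exclusion estimate
  `0 ≤ 𝒵^ε[f] - 𝒵^ε[1_S f] ≤ μ (∫ 1_{Sᶜ} f) 𝒵^ε[f]` (the grand-canonical ensemble needs no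
  ratio lemma: the Poisson weights resum exactly);
* `integral_indicator_compl_separated_le`: `S_ε(Z_s)ᶜ` lies over the union of the `s` balls
  `{x | |x - x_i| < ε}` (this is where the symmetry `|sepVec x y| = |sepVec y x|` of the
  separation map enters), so `∫ 1_{S_εᶜ} f₀ ≤ s C ε^d ∫ g` for `f₀(x, v) ≤ g(v)` and balls of
  volume `≤ C r^d`;
* `correlationFn_gcInitial_tendsto_tensorPow_holds`: for `0 < ε < min_{i ≠ j} |x_i - x_j|`,
  `f₀^{⊗s}(Z_s) (1 - s C (∫|g|) μ_ε ε^d) ≤ F^{(s)}_ε(Z_s) ≤ f₀^{⊗s}(Z_s)` with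
  `μ_ε ε^d = ε`; squeeze.

Supporting facts: summability of the grand-canonical series, `𝒵_N ≤ (∫ f)^N`, `𝒵_0 = 1` and
integrability of tensor powers are `private` copies of helpers of the sibling
`BBGKYMarginalsProofs.lean` (which is being extended concurrently by other discharges; this
file deliberately imports only the statement file `BBGKYMarginals.lean`); `1 ≤ 𝒵^ε`
(`one_le_gcPartition`), monotonicity `𝒵^ε[1_S f] ≤ 𝒵^ε[f]` (`gcPartition_indicator_le`) and
σ-finiteness of `volume` on `X` from the ball-volume bound (`sigmaFinite_volume_of_ball_le`)
are proved here.

## Design notes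

* The named fact quantifies over an arbitrary `[MeasureSpace X]` (its `def` does not pick up
  the ambient `[SigmaFinite volume]` of its section), while Fubini on `(X × ℝ^d)^N`
  (`MeasureTheory.Integrable.fintype_prod`, `integral_fintype_prod_volume_eq_pow`,
  `measurePreserving_piFinSuccAbove`) needs σ-finiteness. It is recovered inside the proof from
  the ball-volume hypothesis `hvol` (`C ≠ ∞`): the balls `{y | |sepVec y x₀| < n}` exhaust `X`
  (and an empty `X` carries the zero measure). All auxiliary statements assume
  `[SigmaFinite (volume : Measure X)]` explicitly.
* The dominating function `g` of the fact is not assumed nonnegative or even integrable in a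
  signed sense beyond `Integrable g`; the proof uses `|g|` (`f₀ ≤ g ≤ |g|`).
* Only the first-order (linear in `μ ∫ 1_{Sᶜ} f`) exclusion estimate is proved, not the
  exponential one `𝒵^ε[f] ≤ 𝒵^ε[1_S f] exp (μ ∫ 1_{Sᶜ} f)`; it suffices for the limit and
  avoids Cauchy products.
* No new definitions: the compatible set `S_ε(Z_s)` is written out as a set-builder term at
  each occurrence, so that this file is a pure-proof companion.

## References

* I. Gallagher, L. Saint-Raymond, B. Texier, *From Newton to Boltzmann: hard spheres and
  short-range potentials*, Zurich Lectures in Advanced Mathematics, EMS (2013); corrected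
  version arXiv:1208.5753v3 (held as `lit paper:arxiv-1208.5753`), Ch. 6 §6.1: Lemma 6.1.2
  (`1 ≤ 𝒵_N⁻¹ 𝒵_{N-s} ≤ (1 - ε κ_d |f_0|)^{-s}`), Prop. 6.1.2 of the printed book = Prop.
  `init-cv1` of §6.1.3 in arXiv v3 (chaotic conditioned data are admissible; proof, second
  step). Bib keys `GST2013`, `GallagherSaintRaymondTexier2013`.
* T. Bodineau, I. Gallagher, L. Saint-Raymond, S. Simonella, *Long-time correlations for a
  hard-sphere gas at equilibrium*, Comm. Pure Appl. Math. (2023), §1.1 (1.1.5)–(1.1.6)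
  (grand-canonical Gibbs-type data and rescaled correlation functions). Bib key `BGSS2023`.
-/

open MeasureTheory Set Filter Topology
open scoped ENNReal Nat

namespace Literature.Analysis.FluidPDE

noncomputable section

section Kinetic

variable {d : Type*} [Fintype d] {X : Type*}

/-! ## Juxtaposed configurations and the hard-sphere domain -/

/-- An index of the first block of `Fin (s + p)` is never an index of the second block.
[folklore] -/
theorem castAdd_ne_natAdd {s p : ℕ} (i : Fin s) (j : Fin p) :
    Fin.castAdd p i ≠ Fin.natAdd s j := by
  intro e
  have h := congrArg Fin.val e
  rw [Fin.val_castAdd, Fin.val_natAdd] at h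
  have := i.isLt
  omega

/-- A juxtaposed configuration `(Z_s, Z_p)` lies in the hard-sphere domain `D_ε^{s+p}` iff both
blocks do and all cross pairs are `ε`-separated (in both orders of the separation vector).
[folklore] -/
theorem append_mem_hardSphereDomain_iff (G : Geometry d X) (ε : ℝ) {s p : ℕ} (Zs : Config s d X)
    (zp : Config p d X) :
    Fin.append Zs zp ∈ hardSphereDomain G (s + p) ε ↔
      Zs ∈ hardSphereDomain G s ε ∧ zp ∈ hardSphereDomain G p ε ∧
        ∀ i j, ε ≤ ‖G.sepVec (Zs i).1 (zp j).1‖ ∧ ε ≤ ‖G.sepVec (zp j).1 (Zs i).1‖ := by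
  simp only [mem_hardSphereDomain, Fin.forall_fin_add, Fin.append_left, Fin.append_right, ne_eq,
    Fin.castAdd_inj, Fin.natAdd_inj, castAdd_ne_natAdd, (castAdd_ne_natAdd _ _).symm,
    not_false_eq_true, forall_const]
  constructor
  · rintro ⟨h1, h2⟩
    exact ⟨fun i i' h => (h1 i).1 i' h, fun j j' h => (h2 j).2 j' h,
      fun i j => ⟨(h1 i).2 j, (h2 j).1 i⟩⟩
  · rintro ⟨hZ, hz, hc⟩
    exact ⟨fun i => ⟨fun i' h => hZ i i' h, fun j => (hc i j).1⟩,
      fun j => ⟨fun i => (hc i j).2, fun j' h => hz j j' h⟩⟩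

/-- **Factorisation of the Gibbs-type weight over a juxtaposition.** For a tagged configuration
`Z_s` and added particles `Z_p`,
`1_{D_ε^{s+p}}(Z_s, Z_p) f^{⊗(s+p)}(Z_s, Z_p) = 1_{D_ε^s}(Z_s) f^{⊗s}(Z_s) · 1_{D_ε^p}(Z_p) (1_S f)^{⊗p}(Z_p)`,
where `S = S_ε(Z_s)` is the set of one-particle states `ε`-separated (in both orders) from every
tagged particle (GST 2013, proof of Prop. 6.1.2, second step: the cross exclusion factor
`∏_{i ≤ s < j} 1_{|x_i - x_j| > ε}`). [cite: GST2013, Prop. 6.1.2 (proof, second step)] -/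
theorem indicator_hardSphereDomain_tensorPow_append (G : Geometry d X) (ε : ℝ) {s p : ℕ}
    (f : X × EuclideanSpace ℝ d → ℝ) (Zs : Config s d X) (zp : Config p d X) :
    (hardSphereDomain G (s + p) ε).indicator (tensorPow (s + p) f) (Fin.append Zs zp) =
      (hardSphereDomain G s ε).indicator (tensorPow s f) Zs *
        (hardSphereDomain G p ε).indicator (tensorPow p
          ({z : X × EuclideanSpace ℝ d |
              ∀ i, ε ≤ ‖G.sepVec (Zs i).1 z.1‖ ∧ ε ≤ ‖G.sepVec z.1 (Zs i).1‖}.indicator f)) zp := by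
  classical
  set S : Set (X × EuclideanSpace ℝ d) :=
    {z | ∀ i, ε ≤ ‖G.sepVec (Zs i).1 z.1‖ ∧ ε ≤ ‖G.sepVec z.1 (Zs i).1‖} with hS
  by_cases hZ : Zs ∈ hardSphereDomain G s ε
  swap
  · have hn : Fin.append Zs zp ∉ hardSphereDomain G (s + p) ε := fun h =>
      hZ ((append_mem_hardSphereDomain_iff G ε Zs zp).1 h).1
    rw [indicator_of_notMem hn, indicator_of_notMem hZ, zero_mul]
  by_cases hz : zp ∈ hardSphereDomain G p ε
  swap
  · have hn : Fin.append Zs zp ∉ hardSphereDomain G (s + p) ε := fun h =>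
      hz ((append_mem_hardSphereDomain_iff G ε Zs zp).1 h).2.1
    rw [indicator_of_notMem hn, indicator_of_notMem hz, mul_zero]
  rw [indicator_of_mem hZ, indicator_of_mem hz]
  by_cases hc : ∀ j, zp j ∈ S
  · have hmem : Fin.append Zs zp ∈ hardSphereDomain G (s + p) ε :=
      (append_mem_hardSphereDomain_iff G ε Zs zp).2 ⟨hZ, hz, fun i j => hc j i⟩
    rw [indicator_of_mem hmem, tensorPow_append]
    congr 1
    exact Finset.prod_congr rfl fun j _ => (indicator_of_mem (hc j) f).symm
  · obtain ⟨j₀, hj₀⟩ := not_forall.1 hc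
    have hn : Fin.append Zs zp ∉ hardSphereDomain G (s + p) ε := fun h =>
      hj₀ fun i => ((append_mem_hardSphereDomain_iff G ε Zs zp).1 h).2.2 i j₀
    have h0 : tensorPow p (S.indicator f) zp = 0 :=
      Finset.prod_eq_zero (Finset.mem_univ j₀) (indicator_of_notMem hj₀ f)
    rw [indicator_of_notMem hn, h0, mul_zero]

/-- Removing particle `i` from a configuration of the hard-sphere domain leaves a configuration
of the hard-sphere domain. [folklore] -/
theorem mem_hardSphereDomain_of_insertNth_mem (G : Geometry d X) (ε : ℝ) {n : ℕ} (i : Fin (n + 1))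
    (z : X × EuclideanSpace ℝ d) (W : Config n d X)
    (h : (i.insertNth z W : Config (n + 1) d X) ∈ hardSphereDomain G (n + 1) ε) :
    W ∈ hardSphereDomain G n ε := by
  intro a b hab
  have := h (i.succAbove a) (i.succAbove b) (fun e => hab (Fin.succAbove_right_injective e))
  simpa only [Fin.insertNth_apply_succAbove] using this

omit [Fintype d] in
/-- **Union bound for the exclusion deficit.** For `0 ≤ f` and a set `S` of one-particle states,
`1_D (f^{⊗(n+1)} - (1_S f)^{⊗(n+1)}) ≤ ∑_i 1_D · (1_{Sᶜ} f)(z_i) · ∏_{j ≠ i} f(z_j)`: if some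
particle is outside `S` the `i`-th term already dominates, otherwise the left side vanishes
(GST 2013, proof of Prop. 6.1.2: `0 ≤ 1 - ∏ 1_{|x_i - x_j| > ε} ≤ ∑ 1_{|x_i - x_j| < ε}`).
[cite: GST2013, Prop. 6.1.2 (proof, second step)] -/
theorem indicator_tensorPow_sub_le_sum {n : ℕ} (D : Set (Config (n + 1) d X))
    {f : X × EuclideanSpace ℝ d → ℝ} (hf : 0 ≤ f) (S : Set (X × EuclideanSpace ℝ d))
    (Z : Config (n + 1) d X) :
    D.indicator (tensorPow (n + 1) f) Z - D.indicator (tensorPow (n + 1) (S.indicator f)) Z ≤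
      ∑ i : Fin (n + 1),
        D.indicator (fun W => Sᶜ.indicator f (W i) * ∏ j, f (W (i.succAbove j))) Z := by
  classical
  have hT : ∀ (i : Fin (n + 1)) (W : Config (n + 1) d X),
      0 ≤ Sᶜ.indicator f (W i) * ∏ j, f (W (i.succAbove j)) := fun i W =>
    mul_nonneg (indicator_nonneg (fun w _ => hf w) _) (Finset.prod_nonneg fun j _ => hf _)
  by_cases hZ : Z ∈ D
  swap
  · simp only [indicator_of_notMem hZ, sub_zero, Finset.sum_const_zero, le_refl]
  simp only [indicator_of_mem hZ]
  by_cases hall : ∀ k, Z k ∈ S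
  · have heq : tensorPow (n + 1) (S.indicator f) Z = tensorPow (n + 1) f Z :=
      Finset.prod_congr rfl fun k _ => indicator_of_mem (hall k) f
    rw [heq, sub_self]
    exact Finset.sum_nonneg fun i _ => hT i Z
  · obtain ⟨i₀, hi₀⟩ := not_forall.1 hall
    have h1 : tensorPow (n + 1) (S.indicator f) Z = 0 :=
      Finset.prod_eq_zero (Finset.mem_univ i₀) (indicator_of_notMem hi₀ f)
    have h2 : tensorPow (n + 1) f Z = Sᶜ.indicator f (Z i₀) * ∏ j, f (Z (i₀.succAbove j)) := by
      rw [indicator_of_mem (mem_compl hi₀)]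
      exact Fin.prod_univ_succAbove _ i₀
    rw [h1, sub_zero, h2]
    exact Finset.single_le_sum (f := fun i => Sᶜ.indicator f (Z i) * ∏ j, f (Z (i.succAbove j)))
      (fun i _ => hT i Z) (Finset.mem_univ i₀)

/-! ## σ-finiteness and measurability -/

section Measurability

variable [MeasurableSpace X]

/-- The set of one-particle states `ε`-separated (in both orders) from all particles of a tagged
configuration is measurable, for a measurable separation map. [folklore] -/
theorem measurableSet_separated {G : Geometry d X}
    (hG : Measurable fun p : X × X => G.sepVec p.1 p.2) (ε : ℝ) {s : ℕ} (Zs : Config s d X) :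
    MeasurableSet {z : X × EuclideanSpace ℝ d |
      ∀ i, ε ≤ ‖G.sepVec (Zs i).1 z.1‖ ∧ ε ≤ ‖G.sepVec z.1 (Zs i).1‖} := by
  have h1 : ∀ i, Measurable fun z : X × EuclideanSpace ℝ d => G.sepVec (Zs i).1 z.1 := fun i =>
    hG.comp (measurable_const.prodMk measurable_fst)
  have h2 : ∀ i, Measurable fun z : X × EuclideanSpace ℝ d => G.sepVec z.1 (Zs i).1 := fun i =>
    hG.comp (measurable_fst.prodMk measurable_const)
  rw [setOf_forall]
  refine MeasurableSet.iInter fun i => ?_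
  rw [setOf_and]
  exact (measurableSet_le measurable_const (h1 i).norm).inter
    (measurableSet_le measurable_const (h2 i).norm)

end Measurability

section SigmaFinite

variable [MeasureSpace X]

/-- **σ-finiteness from the ball-volume bound.** If the "balls" `{y | ‖sepVec y x‖ < r}` of a
geometry have volume `≤ C r^d` with `C < ∞`, then `volume` on `X` is σ-finite (the balls around
any point exhaust `X`; an empty `X` carries the zero measure). This recovers the σ-finiteness
that Fubini on `(X × ℝ^d)^N` needs from the hypothesis `hvol` of
`correlationFn_gcInitial_tendsto_tensorPow`. [folklore] -/
theorem sigmaFinite_volume_of_ball_le {G : Geometry d X} {C : ℝ≥0∞} (hC : C ≠ ∞)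
    (hvolC : ∀ (x : X) (r : ℝ), 0 < r →
      volume {y | ‖G.sepVec y x‖ < r} ≤ C * ENNReal.ofReal (r ^ Fintype.card d)) :
    SigmaFinite (volume : Measure X) := by
  rcases isEmpty_or_nonempty X with hX | ⟨⟨x₀⟩⟩
  · have h0 : volume (univ : Set X) = 0 := by rw [univ_eq_empty_iff.2 hX, measure_empty]
    haveI : IsFiniteMeasure (volume : Measure X) := ⟨by rw [h0]; exact ENNReal.zero_lt_top⟩
    infer_instance
  · refine ⟨⟨⟨fun n => {y | ‖G.sepVec y x₀‖ < n + 1}, fun _ => trivial, fun n => ?_, ?_⟩⟩⟩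
    · calc volume {y | ‖G.sepVec y x₀‖ < n + 1}
          ≤ C * ENNReal.ofReal (((n : ℝ) + 1) ^ Fintype.card d) := hvolC x₀ _ (by positivity)
        _ < ∞ := ENNReal.mul_lt_top hC.lt_top ENNReal.ofReal_lt_top
    · refine eq_univ_of_forall fun y => mem_iUnion.2 ?_
      obtain ⟨n, hn⟩ := exists_nat_gt ‖G.sepVec y x₀‖
      exact ⟨n, by simp only [mem_setOf_eq]; linarith⟩

end SigmaFinite

/-! ## Partition functions: integrability, bounds, summability -/

section Partition

variable [MeasureSpace X] [SigmaFinite (volume : Measure X)]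

omit [Fintype d] in
/-- Tensor powers of an integrable one-particle function are integrable on `(X × ℝ^d)^N`
(Fubini; `MeasureTheory.Integrable.fintype_prod`). A `private` copy of a helper that also
lives (inline or named) in the sibling `BBGKYMarginalsProofs.lean`, kept local so that this
file only depends on the statement file. [folklore] -/
private theorem integrable_tensorPow_of_integrable [Fintype d] (N : ℕ)
    {f : X × EuclideanSpace ℝ d → ℝ} (hf : Integrable f) : Integrable (tensorPow N f : Config N d X → ℝ) := by
  have h := Integrable.fintype_prod (ι := Fin N) (f := fun _ => f)
    (μ := fun _ => (volume : Measure (X × EuclideanSpace ℝ d))) (fun _ => hf)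
  exact h

/-- A tensor power with one factor replaced, `ψ(z_i) ∏_{j ≠ i} f(z_j)`, is integrable for
integrable `ψ`, `f`. [folklore] -/
theorem integrable_eval_mul_prod_succAbove (n : ℕ) (i : Fin (n + 1))
    {ψ f : X × EuclideanSpace ℝ d → ℝ} (hψ : Integrable ψ) (hf : Integrable f) :
    Integrable (fun Z : Config (n + 1) d X => ψ (Z i) * ∏ j, f (Z (i.succAbove j))) := by
  classical
  have h := Integrable.fintype_prod (ι := Fin (n + 1)) (f := fun k => if k = i then ψ else f)
    (μ := fun _ => (volume : Measure (X × EuclideanSpace ℝ d)))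
    (fun k => by by_cases hk : k = i <;> simp [hk, hψ, hf])
  refine (h.congr (ae_of_all _ fun Z => ?_) :)
  change (∏ k, (if k = i then ψ else f) (Z k)) = ψ (Z i) * ∏ j, f (Z (i.succAbove j))
  rw [Fin.prod_univ_succAbove _ i]
  simp [Fin.succAbove_ne]

omit [SigmaFinite (volume : Measure X)] in
/-- The canonical partition function is nonnegative for a nonnegative reference density
(`private` copy of `canonicalPartition_nonneg` of `BBGKYMarginalsProofs.lean`). [folklore] -/
private theorem canonicalPartition_nonneg_of_nonneg (G : Geometry d X) (ε : ℝ) (N : ℕ)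
    {f : X × EuclideanSpace ℝ d → ℝ} (hf : 0 ≤ f) : 0 ≤ canonicalPartition G ε N f :=
  integral_nonneg fun z => indicator_nonneg (fun w _ => tensorPow_nonneg hf N w) z

/-- `𝒵_N ≤ (∫ f)^N`: dropping the exclusion (`1_{D_ε^N} ≤ 1`) and Fubini
(GST 2013 §6.1; BGSS 2023 (1.1.5); `private` copy of the sibling file's
`canonicalPartition_le_pow_integral`). [cite: GST2013, §6.1] -/
private theorem canonicalPartition_le_integral_pow (G : Geometry d X) (ε : ℝ) (N : ℕ)
    {f : X × EuclideanSpace ℝ d → ℝ} (hf : 0 ≤ f) (hf' : Integrable f) :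
    canonicalPartition G ε N f ≤ (∫ z, f z) ^ N := by
  calc canonicalPartition G ε N f
      ≤ ∫ z : Config N d X, tensorPow N f z :=
        integral_mono_of_nonneg (ae_of_all _ fun z =>
          indicator_nonneg (fun w _ => tensorPow_nonneg hf N w) z) (integrable_tensorPow_of_integrable N hf')
          (ae_of_all _ fun z => indicator_le_self' (fun _ _ => tensorPow_nonneg hf N z) z)
    _ = (∫ z, f z) ^ N := by
        have h := integral_fintype_prod_volume_eq_pow (ι := Fin N) f
        rw [Fintype.card_fin] at h
        exact h

/-- Without particles the canonical partition function is `1` (`D_ε^0` is everything, the empty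
tensor power is `1`, and `(X × ℝ^d)^0` is a one-point probability space; `private` copy of the
sibling file's `canonicalPartition_zero_eq_one`). [folklore] -/
private theorem canonicalPartition_zero_left (G : Geometry d X) (ε : ℝ)
    (f : X × EuclideanSpace ℝ d → ℝ) : canonicalPartition G ε 0 f = 1 := by
  have hD : hardSphereDomain G 0 ε = univ := eq_univ_of_forall fun z i => i.elim0
  simp only [canonicalPartition, hD, indicator_univ, tensorPow_zero]
  rw [integral_const, smul_eq_mul, mul_one, Measure.real, volume_pi, Measure.pi_univ]
  simp

/-- **Summability of the grand-canonical series**: `∑_N μ^N 𝒵_N / N!` converges for `μ ≥ 0` and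
a nonnegative integrable reference density, by comparison with `exp (μ ∫ f)` (GST 2013 §6.1;
`private` copy of the sibling file's `summable_gcPartition_term`). [cite: GST2013, §6.1] -/
private theorem summable_gcPartition_series (G : Geometry d X) (ε : ℝ) {μ : ℝ} (hμ : 0 ≤ μ)
    {f : X × EuclideanSpace ℝ d → ℝ} (hf : 0 ≤ f) (hf' : Integrable f) :
    Summable fun N : ℕ => μ ^ N / (N ! : ℝ) * canonicalPartition G ε N f := by
  refine Summable.of_nonneg_of_le (fun N => ?_) (fun N => ?_)
    (Real.summable_pow_div_factorial (μ * ∫ z, f z))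
  · exact mul_nonneg (div_nonneg (pow_nonneg hμ N) (Nat.cast_nonneg _))
      (canonicalPartition_nonneg_of_nonneg G ε N hf)
  · calc μ ^ N / (N ! : ℝ) * canonicalPartition G ε N f
        ≤ μ ^ N / (N ! : ℝ) * (∫ z, f z) ^ N :=
          mul_le_mul_of_nonneg_left (canonicalPartition_le_integral_pow G ε N hf hf')
            (div_nonneg (pow_nonneg hμ N) (Nat.cast_nonneg _))
      _ = (μ * ∫ z, f z) ^ N / (N ! : ℝ) := by rw [mul_pow]; ring

/-- **Positivity of the grand-canonical partition function** on a σ-finite position space: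
the `N = 0` term is `1` and all terms are nonnegative, so `1 ≤ 𝒵^ε` (GST 2013 §6.1; BGSS 2023
(1.1.5)). [cite: GST2013, §6.1] -/
theorem one_le_gcPartition (G : Geometry d X) (ε : ℝ) {μ : ℝ} (hμ : 0 ≤ μ)
    {f : X × EuclideanSpace ℝ d → ℝ} (hf : 0 ≤ f) (hf' : Integrable f) :
    1 ≤ gcPartition G ε μ f := by
  have h := (summable_gcPartition_series G ε hμ hf hf').le_tsum 0 fun N _ =>
    mul_nonneg (div_nonneg (pow_nonneg hμ N) (Nat.cast_nonneg _))
      (canonicalPartition_nonneg_of_nonneg G ε N hf)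
  rw [pow_zero, Nat.factorial_zero, Nat.cast_one, div_one, one_mul,
    canonicalPartition_zero_left] at h
  unfold gcPartition
  exact h

/-- Monotonicity of the grand-canonical partition function under restriction of the reference
density to a measurable set of one-particle states: `𝒵[1_S f] ≤ 𝒵[f]`. [folklore] -/
theorem gcPartition_indicator_le {G : Geometry d X}
    (hG : Measurable fun p : X × X => G.sepVec p.1 p.2) (ε : ℝ) {μ : ℝ} (hμ : 0 ≤ μ)
    {f : X × EuclideanSpace ℝ d → ℝ} (hf : 0 ≤ f) (hf' : Integrable f)
    {S : Set (X × EuclideanSpace ℝ d)} (hS : MeasurableSet S) :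
    gcPartition G ε μ (S.indicator f) ≤ gcPartition G ε μ f := by
  have hSf : 0 ≤ S.indicator f := fun z => indicator_nonneg (fun w _ => hf w) z
  refine Summable.tsum_le_tsum (fun N => ?_)
    (summable_gcPartition_series G ε hμ hSf (hf'.indicator hS)) (summable_gcPartition_series G ε hμ hf hf')
  refine mul_le_mul_of_nonneg_left ?_ (div_nonneg (pow_nonneg hμ N) (Nat.cast_nonneg _))
  refine integral_mono_of_nonneg (ae_of_all _ fun z => indicator_nonneg
    (fun w _ => tensorPow_nonneg hSf N w) z)
    ((integrable_tensorPow_of_integrable N hf').indicator (measurableSet_hardSphereDomain G hG N ε))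
    (ae_of_all _ fun z => ?_)
  refine indicator_le_indicator ?_
  exact Finset.prod_le_prod (fun j _ => hSf _) fun j _ => indicator_le_self' (fun _ _ => hf _) _

/-- **Removing one particle.** For nonnegative integrable `ψ`, `f`:
`∫ 1_{D_ε^{n+1}}(Z) ψ(z_i) ∏_{j ≠ i} f(z_j) dZ ≤ (∫ ψ) 𝒵_n[f]`, since `1_{D_ε^{n+1}}(Z) ≤
1_{D_ε^n}(Z without z_i)` and Fubini (GST 2013, proof of Prop. 6.1.2, the estimate of `𝒵^♭`).
[cite: GST2013, Prop. 6.1.2 (proof, second step)] -/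
theorem integral_indicator_eval_mul_prod_le {G : Geometry d X}
    (hG : Measurable fun p : X × X => G.sepVec p.1 p.2) (ε : ℝ) (n : ℕ) (i : Fin (n + 1))
    {ψ f : X × EuclideanSpace ℝ d → ℝ} (hψ : 0 ≤ ψ) (hψ' : Integrable ψ) (hf : 0 ≤ f)
    (hf' : Integrable f) :
    ∫ Z, (hardSphereDomain G (n + 1) ε).indicator
        (fun W : Config (n + 1) d X => ψ (W i) * ∏ j, f (W (i.succAbove j))) Z ≤
      (∫ z, ψ z) * canonicalPartition G ε n f := by
  set F : Config (n + 1) d X → ℝ := (hardSphereDomain G (n + 1) ε).indicator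
    (fun W : Config (n + 1) d X => ψ (W i) * ∏ j, f (W (i.succAbove j))) with hF
  set e := MeasurableEquiv.piFinSuccAbove (fun _ : Fin (n + 1) => X × EuclideanSpace ℝ d) i
  have hmp : MeasurePreserving e (volume : Measure (Config (n + 1) d X))
      ((volume : Measure (X × EuclideanSpace ℝ d)).prod (volume : Measure (Config n d X))) :=
    measurePreserving_piFinSuccAbove (fun _ => (volume : Measure (X × EuclideanSpace ℝ d))) i
  have h1 : ∫ Z, F Z = ∫ q, F (e.symm q) ∂((volume : Measure (X × EuclideanSpace ℝ d)).prod
      (volume : Measure (Config n d X))) := ((hmp.symm _).integral_comp' F).symm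
  set H : (X × EuclideanSpace ℝ d) × Config n d X → ℝ := fun q =>
    ψ q.1 * (hardSphereDomain G n ε).indicator (tensorPow n f) q.2 with hH
  have hsymm : ∀ q : (X × EuclideanSpace ℝ d) × Config n d X,
      e.symm q = (i.insertNth q.1 q.2 : Config (n + 1) d X) := fun q => rfl
  have hle : ∀ q, F (e.symm q) ≤ H q := by
    intro q
    rw [hsymm q]
    by_cases hq : (i.insertNth q.1 q.2 : Config (n + 1) d X) ∈ hardSphereDomain G (n + 1) ε
    · have hW : q.2 ∈ hardSphereDomain G n ε := mem_hardSphereDomain_of_insertNth_mem G ε i _ _ hq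
      simp only [hF, hH, indicator_of_mem hq, indicator_of_mem hW, Fin.insertNth_apply_same,
        Fin.insertNth_apply_succAbove]
      rfl
    · simp only [hF, hH, indicator_of_notMem hq]
      exact mul_nonneg (hψ _) (indicator_nonneg (fun w _ => tensorPow_nonneg hf n w) _)
  have hnn : ∀ q, 0 ≤ F (e.symm q) := fun q => by
    simp only [hF]
    exact indicator_nonneg
      (fun W _ => mul_nonneg (hψ (W i)) (Finset.prod_nonneg fun j _ => hf (W (i.succAbove j)))) _
  have hHi : Integrable H ((volume : Measure (X × EuclideanSpace ℝ d)).prod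
      (volume : Measure (Config n d X))) :=
    hψ'.mul_prod ((integrable_tensorPow_of_integrable n hf').indicator (measurableSet_hardSphereDomain G hG n ε))
  rw [h1]
  calc ∫ q, F (e.symm q) ∂((volume : Measure (X × EuclideanSpace ℝ d)).prod
        (volume : Measure (Config n d X)))
      ≤ ∫ q, H q ∂((volume : Measure (X × EuclideanSpace ℝ d)).prod
        (volume : Measure (Config n d X))) :=
        integral_mono_of_nonneg (ae_of_all _ hnn) hHi (ae_of_all _ hle)
    _ = (∫ z, ψ z) * canonicalPartition G ε n f := integral_prod_mul ψ _

/-- **First-order exclusion estimate for the canonical partition functions**: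
`𝒵_{n+1}[f] - 𝒵_{n+1}[1_S f] ≤ (n + 1) (∫ 1_{Sᶜ} f) 𝒵_n[f]` (GST 2013, proof of Prop. 6.1.2:
`𝒵^♭_{(s+1,N)} ≤ s (N - s) ε^d κ_d |f_0|_{L^∞L^1} 𝒵_{N-s-1}`, here at the level of an
abstract excluded set `Sᶜ`). [cite: GST2013, Prop. 6.1.2 (proof, second step)] -/
theorem canonicalPartition_succ_sub_indicator_le {G : Geometry d X}
    (hG : Measurable fun p : X × X => G.sepVec p.1 p.2) (ε : ℝ) (n : ℕ)
    {f : X × EuclideanSpace ℝ d → ℝ} (hf : 0 ≤ f) (hf' : Integrable f)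
    {S : Set (X × EuclideanSpace ℝ d)} (hS : MeasurableSet S) :
    canonicalPartition G ε (n + 1) f - canonicalPartition G ε (n + 1) (S.indicator f) ≤
      (n + 1) * (∫ z, Sᶜ.indicator f z) * canonicalPartition G ε n f := by
  set D := hardSphereDomain G (n + 1) ε with hD
  have hDm : MeasurableSet D := measurableSet_hardSphereDomain G hG (n + 1) ε
  have hSf : 0 ≤ Sᶜ.indicator f := fun z => indicator_nonneg (fun w _ => hf w) z
  have hI1 : Integrable (D.indicator (tensorPow (n + 1) f)) :=
    (integrable_tensorPow_of_integrable (n + 1) hf').indicator hDm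
  have hI2 : Integrable (D.indicator (tensorPow (n + 1) (S.indicator f))) :=
    (integrable_tensorPow_of_integrable (n + 1) (hf'.indicator hS)).indicator hDm
  have hIT : ∀ i : Fin (n + 1), Integrable (D.indicator
      (fun W : Config (n + 1) d X => Sᶜ.indicator f (W i) * ∏ j, f (W (i.succAbove j)))) :=
    fun i => (integrable_eval_mul_prod_succAbove n i (hf'.indicator hS.compl) hf').indicator hDm
  calc canonicalPartition G ε (n + 1) f - canonicalPartition G ε (n + 1) (S.indicator f)
      = ∫ Z, (D.indicator (tensorPow (n + 1) f) Z -
          D.indicator (tensorPow (n + 1) (S.indicator f)) Z) := (integral_sub hI1 hI2).symm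
    _ ≤ ∫ Z, ∑ i : Fin (n + 1),
          D.indicator (fun W => Sᶜ.indicator f (W i) * ∏ j, f (W (i.succAbove j))) Z :=
        integral_mono (hI1.sub hI2) (integrable_finsetSum _ fun i _ => hIT i) fun Z =>
          indicator_tensorPow_sub_le_sum D hf S Z
    _ = ∑ i : Fin (n + 1),
          ∫ Z, D.indicator (fun W => Sᶜ.indicator f (W i) * ∏ j, f (W (i.succAbove j))) Z :=
        integral_finsetSum _ fun i _ => hIT i
    _ ≤ ∑ _i : Fin (n + 1), (∫ z, Sᶜ.indicator f z) * canonicalPartition G ε n f :=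
        Finset.sum_le_sum fun i _ =>
          integral_indicator_eval_mul_prod_le hG ε n i hSf (hf'.indicator hS.compl) hf hf'
    _ = (n + 1) * (∫ z, Sᶜ.indicator f z) * canonicalPartition G ε n f := by
        rw [Finset.sum_const, Finset.card_univ, Fintype.card_fin, nsmul_eq_mul]
        push_cast
        ring

/-- **First-order exclusion estimate for the grand-canonical partition function**:
`𝒵[f] - 𝒵[1_S f] ≤ μ (∫ 1_{Sᶜ} f) 𝒵[f]` for `μ ≥ 0`, `0 ≤ f` integrable and `S` measurable —
summing `canonicalPartition_succ_sub_indicator_le` against `μ^{n+1}/(n+1)!`. This is the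
grand-canonical form of the two rate-`ε` estimates `1 - 𝒵_N⁻¹ 𝒵_{N-s} → 0` (GST 2013
Lemma 6.1.2) and `𝒵_N⁻¹ 𝒵^♭_{(s+1,N)} → 0` (proof of Prop. 6.1.2) of the canonical ensemble;
in the grand-canonical ensemble the Poisson weights resum exactly and no ratio lemma is needed
(BGSS 2023 §1.1). [cite: GST2013, Prop. 6.1.2 (proof, second step) and Lemma 6.1.2] -/
theorem gcPartition_sub_indicator_le {G : Geometry d X}
    (hG : Measurable fun p : X × X => G.sepVec p.1 p.2) (ε : ℝ) {μ : ℝ} (hμ : 0 ≤ μ)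
    {f : X × EuclideanSpace ℝ d → ℝ} (hf : 0 ≤ f) (hf' : Integrable f)
    {S : Set (X × EuclideanSpace ℝ d)} (hS : MeasurableSet S) :
    gcPartition G ε μ f - gcPartition G ε μ (S.indicator f) ≤
      μ * (∫ z, Sᶜ.indicator f z) * gcPartition G ε μ f := by
  set c : ℝ := ∫ z, Sᶜ.indicator f z with hc
  set t : ℕ → ℝ := fun N => μ ^ N / (N ! : ℝ) * canonicalPartition G ε N f with ht
  set u : ℕ → ℝ := fun N => μ ^ N / (N ! : ℝ) * canonicalPartition G ε N (S.indicator f) with hu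
  have hSf : 0 ≤ S.indicator f := fun z => indicator_nonneg (fun w _ => hf w) z
  have hts : Summable t := summable_gcPartition_series G ε hμ hf hf'
  have hus : Summable u := summable_gcPartition_series G ε hμ hSf (hf'.indicator hS)
  have hstep : ∀ n, t (n + 1) - u (n + 1) ≤ μ * c * t n := by
    intro n
    have h := canonicalPartition_succ_sub_indicator_le hG ε n hf hf' hS
    have hcoef : 0 ≤ μ ^ (n + 1) / ((n + 1) ! : ℝ) := div_nonneg (pow_nonneg hμ _) (Nat.cast_nonneg _)
    calc t (n + 1) - u (n + 1)
        = μ ^ (n + 1) / ((n + 1) ! : ℝ) * (canonicalPartition G ε (n + 1) f -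
            canonicalPartition G ε (n + 1) (S.indicator f)) := by simp only [ht, hu]; ring
      _ ≤ μ ^ (n + 1) / ((n + 1) ! : ℝ) * ((n + 1) * c * canonicalPartition G ε n f) :=
          mul_le_mul_of_nonneg_left h hcoef
      _ = μ * c * t n := by
          simp only [ht]
          rw [Nat.factorial_succ, Nat.cast_mul, pow_succ]
          push_cast
          field_simp
  have h0 : t 0 - u 0 = 0 := by simp [ht, hu, canonicalPartition_zero_left]
  have hshift : Summable fun n => t (n + 1) - u (n + 1) := (summable_nat_add_iff 1).2 (hts.sub hus)
  calc gcPartition G ε μ f - gcPartition G ε μ (S.indicator f)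
      = ∑' N, (t N - u N) := (hts.tsum_sub hus).symm
    _ = (t 0 - u 0) + ∑' n, (t (n + 1) - u (n + 1)) := (hts.sub hus).tsum_eq_zero_add
    _ ≤ 0 + ∑' n, μ * c * t n :=
        add_le_add h0.le (hshift.tsum_le_tsum hstep (hts.mul_left _))
    _ = μ * c * gcPartition G ε μ f := by rw [zero_add, tsum_mul_left]; rfl

end Partition

/-! ## The correlation functions as a ratio of partition functions -/

section Correlation

variable [MeasureSpace X]

/-- **The initial correlation functions as a ratio of partition functions** (the
grand-canonical form of the "second step" of the proof of GST 2013 Prop. 6.1.2, formula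
`f_{0,N}^{(s)} = 𝒵_N⁻¹ 1_{D_s} f_0^{⊗s} (𝒵_{N-s} - 𝒵^♭_{(s+1,N)})`; BGSS 2023 (1.1.6)): for
every activity `μ ≠ 0`, every `ε`, every `f₀` and every configuration `Z_s`,
`F^{(s)}(Z_s) = 1_{D_ε^s}(Z_s) f₀^{⊗s}(Z_s) · 𝒵^ε[1_{S_ε(Z_s)} f₀] / 𝒵^ε[f₀]`, where
`S_ε(Z_s)` is the set of one-particle states `ε`-separated from every tagged particle and
`𝒵^ε[h] = gcPartition G ε μ h`. An exact identity of `tsum`s of Bochner integrals (no sign,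
integrability or σ-finiteness assumption; both sides are `0` when `𝒵^ε[f₀] = 0`).
[cite: GST2013, Prop. 6.1.2 (proof, second step)] -/
theorem correlationFn_gcInitial_eq_mul_div (G : Geometry d X) (ε : ℝ) {μ : ℝ} (hμ : μ ≠ 0)
    (f₀ : X × EuclideanSpace ℝ d → ℝ) (s : ℕ) (Zs : Config s d X) :
    correlationFn μ (gcInitial G ε μ f₀) s Zs =
      (hardSphereDomain G s ε).indicator (tensorPow s f₀) Zs *
        (gcPartition G ε μ ({z : X × EuclideanSpace ℝ d |
            ∀ i, ε ≤ ‖G.sepVec (Zs i).1 z.1‖ ∧ ε ≤ ‖G.sepVec z.1 (Zs i).1‖}.indicator f₀) /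
          gcPartition G ε μ f₀) := by
  set S : Set (X × EuclideanSpace ℝ d) :=
    {z | ∀ i, ε ≤ ‖G.sepVec (Zs i).1 z.1‖ ∧ ε ≤ ‖G.sepVec z.1 (Zs i).1‖} with hS
  set A : ℝ := (hardSphereDomain G s ε).indicator (tensorPow s f₀) Zs with hA
  set Z : ℝ := gcPartition G ε μ f₀ with hZ
  have hmarg : ∀ p, marginal s p (gcInitial G ε μ f₀ (s + p)) Zs =
      Z⁻¹ * μ ^ (s + p) * A * canonicalPartition G ε p (S.indicator f₀) := by
    intro p
    simp only [marginal, gcInitial, canonicalPartition, ← hZ]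
    rw [← integral_const_mul]
    refine integral_congr_ae (ae_of_all _ fun zp => ?_)
    dsimp only
    rw [indicator_hardSphereDomain_tensorPow_append]
    ring
  have hterm : ∀ p, (p ! : ℝ)⁻¹ *
      (Z⁻¹ * μ ^ (s + p) * A * canonicalPartition G ε p (S.indicator f₀)) =
      (μ ^ s * Z⁻¹ * A) * (μ ^ p / (p ! : ℝ) * canonicalPartition G ε p (S.indicator f₀)) := by
    intro p; rw [pow_add]; ring
  unfold correlationFn
  simp_rw [hmarg, hterm]
  rw [tsum_mul_left]
  unfold gcPartition
  rw [mul_assoc, mul_assoc, inv_mul_cancel_left₀ (pow_ne_zero s hμ)]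
  ring

/-- **Excluded volume around the tagged particles** (the grand-canonical counterpart of the
estimate `𝒵^♭ ≤ s (N - s) ε^d κ_d |f_0|_{L^∞ L^1} 𝒵_{N-s-1}` in the proof of GST 2013
Prop. 6.1.2): with `S_ε(Z_s)` as above, a symmetric-norm separation map whose balls have volume
`≤ C r^d`, and `0 ≤ f₀(x, v) ≤ g(v)` with `g ≥ 0` integrable,
`∫ 1_{S_ε(Z_s)ᶜ} f₀ ≤ s C ε^d ∫ g` (the complement of `S_ε(Z_s)` lies over the union of the
`s` balls of radius `ε` around the tagged positions; Fubini in `(x, v)`).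
[cite: GST2013, Prop. 6.1.2 (proof, second step)] -/
theorem integral_indicator_compl_separated_le [SigmaFinite (volume : Measure X)] {G : Geometry d X}
    (hG : Measurable fun p : X × X => G.sepVec p.1 p.2)
    (hsym : ∀ x y : X, ‖G.sepVec x y‖ = ‖G.sepVec y x‖) {C : ℝ≥0∞} (hC : C ≠ ∞)
    (hvolC : ∀ (x : X) (r : ℝ), 0 < r →
      volume {y | ‖G.sepVec y x‖ < r} ≤ C * ENNReal.ofReal (r ^ Fintype.card d))
    {f₀ : X × EuclideanSpace ℝ d → ℝ} (hf₀ : 0 ≤ f₀) {g : EuclideanSpace ℝ d → ℝ} (hg₀ : 0 ≤ g)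
    (hg : Integrable g) (hfg : ∀ x v, f₀ (x, v) ≤ g v) {s : ℕ} (Zs : Config s d X) {ε : ℝ}
    (hε : 0 < ε) :
    ∫ z, ({z : X × EuclideanSpace ℝ d |
        ∀ i, ε ≤ ‖G.sepVec (Zs i).1 z.1‖ ∧ ε ≤ ‖G.sepVec z.1 (Zs i).1‖}ᶜ).indicator f₀ z ≤
      s * C.toReal * ε ^ Fintype.card d * ∫ v, g v := by
  set S : Set (X × EuclideanSpace ℝ d) :=
    {z | ∀ i, ε ≤ ‖G.sepVec (Zs i).1 z.1‖ ∧ ε ≤ ‖G.sepVec z.1 (Zs i).1‖} with hS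
  set B : Set X := ⋃ i : Fin s, {x | ‖G.sepVec x (Zs i).1‖ < ε} with hB
  have hBm : MeasurableSet B := MeasurableSet.iUnion fun i =>
    measurableSet_lt (hG.comp (measurable_id.prodMk measurable_const)).norm measurable_const
  have hBvol : volume B ≤ (s : ℝ≥0∞) * (C * ENNReal.ofReal (ε ^ Fintype.card d)) := by
    calc volume B ≤ ∑ i : Fin s, volume {x | ‖G.sepVec x (Zs i).1‖ < ε} :=
          measure_iUnion_fintype_le volume _
      _ ≤ ∑ _i : Fin s, C * ENNReal.ofReal (ε ^ Fintype.card d) :=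
          Finset.sum_le_sum fun i _ => hvolC _ _ hε
      _ = (s : ℝ≥0∞) * (C * ENNReal.ofReal (ε ^ Fintype.card d)) := by
          rw [Finset.sum_const, Finset.card_univ, Fintype.card_fin, nsmul_eq_mul]
  have hfin : (s : ℝ≥0∞) * (C * ENNReal.ofReal (ε ^ Fintype.card d)) ≠ ∞ :=
    ENNReal.mul_ne_top (ENNReal.natCast_ne_top s) (ENNReal.mul_ne_top hC ENNReal.ofReal_ne_top)
  have hBfin : volume B ≠ ∞ := ne_top_of_le_ne_top hfin hBvol
  set U : X × EuclideanSpace ℝ d → ℝ := fun z => B.indicator (fun _ => (1 : ℝ)) z.1 * g z.2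
    with hU
  have hUi : Integrable U := by
    have h1 : Integrable (B.indicator fun _ => (1 : ℝ)) (volume : Measure X) :=
      (integrable_indicator_iff hBm).2 (integrableOn_const hBfin)
    exact h1.mul_prod hg
  have hle : ∀ z, Sᶜ.indicator f₀ z ≤ U z := by
    intro z
    by_cases hz : z ∈ Sᶜ
    · have hz1 : z.1 ∈ B := by
        rw [mem_compl_iff, hS] at hz
        simp only [mem_setOf_eq, not_forall, not_and_or, not_le] at hz
        obtain ⟨i, hi⟩ := hz
        refine mem_iUnion.2 ⟨i, ?_⟩
        rcases hi with h | h
        · rw [mem_setOf_eq, hsym]; exact h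
        · exact h
      rw [indicator_of_mem hz]
      simp only [hU, indicator_of_mem hz1, one_mul]
      exact hfg z.1 z.2
    · rw [indicator_of_notMem hz]
      exact mul_nonneg (indicator_nonneg (fun _ _ => zero_le_one) _) (hg₀ _)
  calc ∫ z, Sᶜ.indicator f₀ z
      ≤ ∫ z, U z := integral_mono_of_nonneg
        (ae_of_all _ fun z => indicator_nonneg (fun w _ => hf₀ w) z) hUi (ae_of_all _ hle)
    _ = (∫ x, B.indicator (fun _ => (1 : ℝ)) x) * ∫ v, g v := integral_prod_mul _ g
    _ = (volume B).toReal * ∫ v, g v := by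
        rw [integral_indicator_const _ hBm, smul_eq_mul, mul_one, Measure.real]
    _ ≤ ((s : ℝ≥0∞) * (C * ENNReal.ofReal (ε ^ Fintype.card d))).toReal * ∫ v, g v :=
        mul_le_mul_of_nonneg_right (ENNReal.toReal_mono hfin hBvol) (integral_nonneg hg₀)
    _ = s * C.toReal * ε ^ Fintype.card d * ∫ v, g v := by
        rw [ENNReal.toReal_mul, ENNReal.toReal_mul, ENNReal.toReal_natCast,
          ENNReal.toReal_ofReal (pow_nonneg hε.le _)]
        ring

/-! ## Chaos of the grand-canonical data in the Boltzmann–Grad limit -/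

/-- **Chaos of the grand-canonical Gibbs-type data in the Boltzmann–Grad limit** — discharge of
the named fact `correlationFn_gcInitial_tendsto_tensorPow` (pointwise grand-canonical analogue
of GST 2013 Prop. 6.1.2 — arXiv v3: §6.1.3 Prop. `init-cv1` —; BGSS 2023 §1.1
(1.1.5)–(1.1.6) for the grand-canonical data). Proof (the architecture of GST 2013, proof of
Prop. 6.1.2, transposed to the grand-canonical ensemble, where the two error terms
`1 - 𝒵_N⁻¹ 𝒵_{N-s}` and `𝒵_N⁻¹ 𝒵^♭_{(s+1,N)}` merge into the single ratio below): the ball-volume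
hypothesis makes `volume` on `X` σ-finite (`sigmaFinite_volume_of_ball_le`), so that Fubini on
`(X × ℝ^d)^N` is available; for `0 < ε < min_{i ≠ j} |x_i - x_j|` the tagged configuration lies
in `D_ε^s` and `F^{(s)}_ε(Z_s) = f₀^{⊗s}(Z_s) R_ε` with
`R_ε = 𝒵^ε[1_{S_ε(Z_s)} f₀] / 𝒵^ε[f₀]` (`correlationFn_gcInitial_eq_mul_div`); by monotonicity
and the first-order exclusion estimate (`gcPartition_indicator_le`,
`gcPartition_sub_indicator_le`) `1 - μ_ε ∫ 1_{S_εᶜ} f₀ ≤ R_ε ≤ 1`, and by the excluded-volume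
bound (`integral_indicator_compl_separated_le`) `μ_ε ∫ 1_{S_εᶜ} f₀ ≤ s C (∫ |g|) μ_ε ε^d
= s C (∫ |g|) ε → 0` in the scaling `μ_ε ε^{d-1} = 1`; squeeze.
[cite: GST2013, Prop. 6.1.2] -/
theorem correlationFn_gcInitial_tendsto_tensorPow_holds :
    correlationFn_gcInitial_tendsto_tensorPow (d := d) (X := X) := by
  intro hd G hG hsym hvol f₀ hf₀ hf₀' g hg hfg s Zs hZs
  obtain ⟨C, hC, hvolC⟩ := hvol
  haveI : SigmaFinite (volume : Measure X) := sigmaFinite_volume_of_ball_le hC hvolC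
  obtain ⟨m, hm⟩ : ∃ m : ℕ, Fintype.card d = m + 1 := ⟨Fintype.card d - 1, by omega⟩
  set A : ℝ := tensorPow s f₀ Zs with hA
  have hA0 : 0 ≤ A := tensorPow_nonneg hf₀ s Zs
  set K : ℝ := s * C.toReal * ∫ v, |g v| with hK
  -- squeeze between `A (1 - K ε)` and `A`
  have hlow : Tendsto (fun ε : ℝ => A * (1 - K * ε)) (𝓝[>] 0) (𝓝 A) := by
    have h : Tendsto (fun ε : ℝ => A * (1 - K * ε)) (𝓝 0) (𝓝 (A * (1 - K * 0))) :=
      tendsto_const_nhds.mul (tendsto_const_nhds.sub (tendsto_const_nhds.mul tendsto_id))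
    rw [mul_zero, sub_zero, mul_one] at h
    exact h.mono_left nhdsWithin_le_nhds
  -- eventually `0 < ε` and `Z_s ∈ D_ε^s`
  have h1 : ∀ᶠ ε in 𝓝[>] (0 : ℝ), 0 < ε := eventually_mem_nhdsWithin
  have h2 : ∀ᶠ ε in 𝓝[>] (0 : ℝ), ∀ q : Fin s × Fin s, q.1 ≠ q.2 →
      ε ≤ ‖G.sepVec (Zs q.1).1 (Zs q.2).1‖ := by
    refine eventually_all.2 fun q => ?_
    by_cases hq : q.1 = q.2
    · exact Eventually.of_forall fun ε h => (h hq).elim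
    · have hpos : (0 : ℝ) < ‖G.sepVec (Zs q.1).1 (Zs q.2).1‖ := norm_pos_iff.2 (hZs _ _ hq)
      exact ((eventually_lt_nhds hpos).filter_mono nhdsWithin_le_nhds).mono fun ε hε _ => hε.le
  have hboth : ∀ᶠ ε in 𝓝[>] (0 : ℝ),
      A * (1 - K * ε) ≤ correlationFn (ε⁻¹ ^ (Fintype.card d - 1))
          (gcInitial G ε (ε⁻¹ ^ (Fintype.card d - 1)) f₀) s Zs ∧
        correlationFn (ε⁻¹ ^ (Fintype.card d - 1))
          (gcInitial G ε (ε⁻¹ ^ (Fintype.card d - 1)) f₀) s Zs ≤ A := by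
    filter_upwards [h1, h2] with ε hε hsep
    -- notation for this `ε`
    set μ : ℝ := ε⁻¹ ^ (Fintype.card d - 1) with hμdef
    have hμ : 0 < μ := pow_pos (inv_pos.2 hε) _
    have hscale : μ * ε ^ Fintype.card d = ε := by
      rw [hμdef, hm, Nat.add_sub_cancel, pow_succ, ← mul_assoc, inv_pow,
        inv_mul_cancel₀ (pow_ne_zero m hε.ne'), one_mul]
    have hZsD : Zs ∈ hardSphereDomain G s ε := fun i j hij => hsep (i, j) hij
    set S : Set (X × EuclideanSpace ℝ d) :=
      {z | ∀ i, ε ≤ ‖G.sepVec (Zs i).1 z.1‖ ∧ ε ≤ ‖G.sepVec z.1 (Zs i).1‖} with hS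
    have hSm : MeasurableSet S := measurableSet_separated hG ε Zs
    have hZpos : 0 < gcPartition G ε μ f₀ :=
      zero_lt_one.trans_le (one_le_gcPartition G ε hμ.le hf₀ hf₀')
    have hmono : gcPartition G ε μ (S.indicator f₀) ≤ gcPartition G ε μ f₀ :=
      gcPartition_indicator_le hG ε hμ.le hf₀ hf₀' hSm
    have hclus := gcPartition_sub_indicator_le hG ε hμ.le hf₀ hf₀' hSm
    have hexcl : ∫ z, Sᶜ.indicator f₀ z ≤ s * C.toReal * ε ^ Fintype.card d * ∫ v, |g v| :=
      integral_indicator_compl_separated_le hG hsym hC hvolC hf₀ (fun v => abs_nonneg (g v))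
        hg.abs (fun x v => (hfg x v).trans (le_abs_self _)) Zs hε
    have hc0 : 0 ≤ ∫ z, Sᶜ.indicator f₀ z :=
      integral_nonneg fun z => indicator_nonneg (fun w _ => hf₀ w) z
    have hμc : μ * ∫ z, Sᶜ.indicator f₀ z ≤ K * ε := by
      calc μ * ∫ z, Sᶜ.indicator f₀ z
          ≤ μ * (s * C.toReal * ε ^ Fintype.card d * ∫ v, |g v|) :=
            mul_le_mul_of_nonneg_left hexcl hμ.le
        _ = K * (μ * ε ^ Fintype.card d) := by rw [hK]; ring
        _ = K * ε := by rw [hscale]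
    rw [correlationFn_gcInitial_eq_mul_div G ε hμ.ne' f₀ s Zs, indicator_of_mem hZsD]
    constructor
    · refine mul_le_mul_of_nonneg_left ?_ hA0
      rw [le_div_iff₀ hZpos]
      have := mul_le_mul_of_nonneg_right hμc hZpos.le
      nlinarith [hclus, this]
    · exact mul_le_of_le_one_right hA0 (div_le_one_of_le₀ hmono hZpos.le)
  exact tendsto_of_tendsto_of_tendsto_of_le_of_le' hlow tendsto_const_nhds
    (hboth.mono fun ε h => h.1) (hboth.mono fun ε h => h.2)

end Correlation

end Kinetic

end

end Literature.Analysis.FluidPDE
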